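import Summits.Ventures.PercRepro.ThetaOmegaGraph

/-!
# The graph form of (Ω), continued: symmetry is load-bearing, and the conjecture of the record

`ThetaOmegaGraph.lean` states the graph form `OmegaGraph` for an arbitrary relation `Γ` on the
slots. That is one relation too many: the count consults a pair of slots in ONE orientation only
(first–first and second–second pairs in both orders, a first slot before a second slot), while
`SlotTripleRel` accepts either orientation, so for an ASYMMETRIC `Γ` the triple condition can be
met by pairs the count never sees. This file records the consequence and the corrected statement:

* `asymR`, `asymR_tripleRel`, `not_omegaRel_asymR` — a relation on `Fin 4` with the triple
  condition whose relation form FAILS (`{∅, {x}, {y}}` labelled `0, 0, 1` / `2, 2, 3` counts `∅`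
  and `{y}` only): symmetry is load-bearing in the dichotomy «(Ω_R) iff reflexive and `R̄`
  triangle-free» — the dichotomy is a statement about SYMMETRIC relations;
* `not_omegaGraph` — hence the unsymmetrised `OmegaGraph α` is FALSE on every type with two
  points (`omegaRel_of_omegaGraph` would give the relation form for `asymR`);
* `OmegaGraphSymm α` — **Conjecture (Ω_Γ), the graph form of the record**: the graph is required
  to be symmetric; `omegaRel_of_omegaGraphSymm` / `omegaGraphSymm_of_omegaRel` — it is equivalent
  to the relation form for every symmetric relation with the triple condition;
  `omegaRel_pentR_of_omegaGraphSymm` — it contains (PENT). The theorems `omegaRel_of_omegaGraph`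
  and `omegaGraph_of_omegaRel` of the first file remain true, with both sides false.
-/

namespace PercRepro.MSTight

open Finset

variable {α : Type*} [DecidableEq α] {L : Type*}

section Symmetric


/-- The asymmetric relation on `Fin 4`: equal labels, or a label `≥ 2` before a label `< 2`. Any
three distinct labels contain one of each kind, so the triple condition holds; but a label `< 2`
is never related to a label `≥ 2` in that order. -/
abbrev asymR (x y : Fin 4) : Prop := x = y ∨ (2 ≤ x ∧ y < 2)

/-- `asymR` has the triple condition. -/
theorem asymR_tripleRel : TripleRel asymR := by
  unfold TripleRel asymR
  decide

/-- **Symmetry is load-bearing**: `asymR` has the triple condition but not the relation form —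
`{∅, {x}, {y}}` with first labels `0, 0, 1` and second labels `2, 2, 3` counts `∅` and `{y}`
only. -/
theorem not_omegaRel_asymR {x y : α} (hxy : x ≠ y) : ¬ OmegaRel α asymR := by
  intro h
  obtain ⟨l0, hl0⟩ : ∃ l : Finset α → Fin 4, l = fun s => if s = {y} then 1 else 0 := ⟨_, rfl⟩
  obtain ⟨l1, hl1⟩ : ∃ l : Finset α → Fin 4, l = fun s => if s = {y} then 3 else 2 := ⟨_, rfl⟩
  obtain ⟨F, hF⟩ : ∃ F : Finset (Finset α), F = {∅, {x}, {y}} := ⟨_, rfl⟩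
  have hxy' : ({x} : Finset α) ≠ {y} := fun h' => hxy (singleton_inj.1 h')
  have hxy_sd : ({x, y} : Finset α) \ {x} = {y} := by
    rw [sdiff_singleton_eq_erase, erase_insert]
    rw [mem_singleton]
    exact hxy
  have h0e : l0 ∅ = 0 := by rw [hl0]; simp [(singleton_ne_empty y).symm]
  have h0x : l0 {x} = 0 := by rw [hl0]; simp [hxy']
  have h0y : l0 {y} = 1 := by rw [hl0]; simp
  have h1e : l1 ∅ = 2 := by rw [hl1]; simp [(singleton_ne_empty y).symm]
  have h1x : l1 {x} = 2 := by rw [hl1]; simp [hxy']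
  have h1y : l1 {y} = 3 := by rw [hl1]; simp
  -- the only related first–first pair is `(∅, {x})`, the only related second–second pair too,
  -- and no first–second pair is related
  have hA : omegaAR asymR F l0 l1 ⊆ {∅} := by
    intro E hE
    rw [mem_singleton]
    rcases mem_omegaAR.1 hE with ⟨s, hs, t, ht, hst, hr, rfl⟩ | ⟨s, hs, t, ht, hr, rfl⟩
    · simp only [hF, mem_insert, mem_singleton] at hs ht
      rcases hs with rfl | rfl | rfl <;> rcases ht with rfl | rfl | rfl <;>
        first
        | exact absurd rfl hst
        | exact empty_inter _
        | exact inter_empty _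
        | (rw [h0x, h0y] at hr; exact absurd hr (by decide))
    · simp only [hF, mem_insert, mem_singleton] at hs ht
      rcases hs with rfl | rfl | rfl <;> rcases ht with rfl | rfl | rfl <;>
        first
        | (rw [h0e, h1e] at hr; exact absurd hr (by decide))
        | (rw [h0e, h1x] at hr; exact absurd hr (by decide))
        | (rw [h0e, h1y] at hr; exact absurd hr (by decide))
        | (rw [h0x, h1e] at hr; exact absurd hr (by decide))
        | (rw [h0x, h1x] at hr; exact absurd hr (by decide))
        | (rw [h0x, h1y] at hr; exact absurd hr (by decide))
        | (rw [h0y, h1e] at hr; exact absurd hr (by decide))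
        | (rw [h0y, h1x] at hr; exact absurd hr (by decide))
        | (rw [h0y, h1y] at hr; exact absurd hr (by decide))
  have hC : omegaCR asymR {x, y} F l1 ⊆ {{y}} := by
    intro E hE
    rw [mem_singleton]
    obtain ⟨s, hs, t, ht, hst, hr, rfl⟩ := mem_omegaCR.1 hE
    simp only [hF, mem_insert, mem_singleton] at hs ht
    rcases hs with rfl | rfl | rfl <;> rcases ht with rfl | rfl | rfl <;>
      first
      | exact absurd rfl hst
      | (rw [h1e, h1y] at hr; exact absurd hr (by decide))
      | (rw [h1x, h1y] at hr; exact absurd hr (by decide))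
      | (simp only [sup_eq_union, empty_union, union_empty]; exact hxy_sd)
  have hsub : ∀ s ∈ F, s ⊆ ({x, y} : Finset α) := by
    intro s hs
    simp only [hF, mem_insert, mem_singleton] at hs
    rcases hs with rfl | rfl | rfl
    · exact empty_subset _
    · exact singleton_subset_iff.2 (mem_insert_self x {y})
    · exact singleton_subset_iff.2 (mem_insert_of_mem (mem_singleton_self y))
  have h3 : F.card = 3 := by rw [hF]; exact card_three_family hxy
  have hcount := h {x, y} F l0 l1 hsub (by omega)
  unfold omegaCountR at hcount
  have hAc : (omegaAR asymR F l0 l1).card ≤ 1 := by simpa using card_le_card hA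
  have hCc : (omegaCR asymR {x, y} F l1).card ≤ 1 := by simpa using card_le_card hC
  omega

/-- **The unsymmetrised graph form is false** on every type with two points: it would give the
relation form for `asymR`. -/
theorem not_omegaGraph {x y : α} (hxy : x ≠ y) : ¬ OmegaGraph α := fun hG =>
  not_omegaRel_asymR hxy (omegaRel_of_omegaGraph hG asymR_tripleRel)

/-- **Conjecture (Ω_Γ), the graph form of the record**: every family of at least three subsets of
a ground set, with any SYMMETRIC graph of independence number at most two on its `2|F|` slots, has
at least `|F|` meets over the edges of the graph. (Symmetry is load-bearing: `not_omegaGraph`.) -/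
def OmegaGraphSymm (α : Type*) [DecidableEq α] : Prop :=
  ∀ (U : Finset α) (F : Finset (Finset α)) (Γ : Slot α → Slot α → Prop) [DecidableRel Γ],
    (∀ u v, Γ u v → Γ v u) → (∀ s ∈ F, s ⊆ U) → 3 ≤ F.card → SlotTripleRel Γ F →
      F.card ≤ omegaCountG Γ U F

variable {R : L → L → Prop} [DecidableRel R]

omit [DecidableEq α] [DecidableRel R] in
/-- A symmetric relation pulls back to a symmetric slot relation. -/
theorem symmetric_slotLabel (hs : ∀ a b, R a b → R b a) (l0 l1 : Finset α → L) :
    ∀ u v, R (slotLabel l0 l1 u) (slotLabel l0 l1 v) → R (slotLabel l0 l1 v) (slotLabel l0 l1 u) :=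
  fun _ _ h => hs _ _ h

/-- **The symmetric graph form gives every symmetric relation form with the triple condition.** -/
theorem omegaRel_of_omegaGraphSymm (hG : OmegaGraphSymm α) (hs : ∀ a b, R a b → R b a)
    (hR : TripleRel R) : OmegaRel α R := by
  intro U F l0 l1 hF h3
  have := hG U F (fun u v => R (slotLabel l0 l1 u) (slotLabel l0 l1 v))
    (symmetric_slotLabel hs l0 l1) hF h3 (slotTripleRel_of_tripleRel hR l0 l1)
  rwa [omegaCountG_slotLabel] at this

variable {Γ : Slot α → Slot α → Prop} [DecidableRel Γ] {F : Finset (Finset α)}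

omit [DecidableEq α] [DecidableRel Γ] in
/-- The relative closure of a symmetric graph is symmetric. -/
theorem symmetric_slotRelOn (hs : ∀ u v, Γ u v → Γ v u) :
    ∀ u v, slotRelOn Γ F u v → slotRelOn Γ F v u := by
  intro u v h
  rcases h with h | h | h | h
  · exact Or.inl h.symm
  · exact Or.inr (Or.inr (Or.inl h))
  · exact Or.inr (Or.inl h)
  · exact Or.inr (Or.inr (Or.inr (hs u v h)))

/-- **Every symmetric relation form with the triple condition gives the symmetric graph form.** -/
theorem omegaGraphSymm_of_omegaRel
    (h : ∀ (R : Slot α → Slot α → Prop) [DecidableRel R], (∀ u v, R u v → R v u) →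
      TripleRel R → OmegaRel α R) :
    OmegaGraphSymm α := by
  intro U F Γ _ hs hF h3 hT
  have := h (slotRelOn Γ F) (symmetric_slotRelOn hs) (tripleRel_slotRelOn hT) U F topSlot
    botSlot hF h3
  unfold omegaCountG omegaCountR
  unfold omegaCountR at this
  rwa [omegaAR_slotRelOn, omegaCR_slotRelOn] at this

/-- The pentagon relation is symmetric. -/
theorem pentR_symmetric : ∀ a b, pentR a b → pentR b a := fun _ _ h => pentR_symm h

/-- **(PENT) is an instance of the symmetric graph form**: `OmegaGraphSymm α` gives
`OmegaRel α pentR` (= `OmegaPentagon α`, the kernel Prop of row C-050). -/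
theorem omegaRel_pentR_of_omegaGraphSymm (hG : OmegaGraphSymm α) : OmegaRel α pentR :=
  omegaRel_of_omegaGraphSymm hG pentR_symmetric pentR_tripleRel

end Symmetric

end PercRepro.MSTight
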